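import Summits.HodgeConjecture.HodgeConjecture.Theorems.R90S2ArchLocalCuspidalLemmas  -- ★ p863699 (S2-R13 Lemmas): `isRegNonEllipticMat_out_mk` (:170); brings ★ p863651 Defs `IsLocCuspidal` (:138), the frame binders of `locFrame`, ★ p862685 `isRegNonEllipticMat_conj_gl` ∕ `_of_isConj_archLocal` ∕ `charpoly_conj_units`, ★ p862403 `IsRegNonEllipticMat`, `exists_isRegNonEllipticMat_two`, ★ `U21_eq_unitaryGroupOfForm`, `unitaryGroupOfFormCongrOfEq`, `formCongr_star`, `BallModel.boostMat`, `boostMat_mem`, `mkU21`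
import HarnessLib

/-!
# R90-TF ∕ S2 «Ch11-arch» — F-C3 NON-EMPTINESS: regular non-elliptic WITNESSES in `U(2,1)_τ` and in the `U(1,1)` block, at element AND conjugacy-class level

Cell `hodgecm-mathlib`, programme R90-TF, section S2 (dealer K2E1b-plan (g8), UP 2026-09-05T01:07:52Z, word (W4) «first card = F-C3 NON-EMPTINESS witnesses of
★ `IsRegNonEllipticMat` on the `U(2,1)_τ` and `U(1,1)` blocks (diagonal-hyperbolic element; audit1's probe shape) as `Theorems/R90S2RegNonEllipticWitness.lean`»;
no prover hand UP in S2, so pre-typed at HOME by the section typist R90-C11-typ1 (g3), D-0071).  Sorry-free, no `def`, no instance, no notation.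

WHAT IT SETTLES (audit R90-C11-audit1 (g0) finding F-C3, 2026-09-04T22:0xZ): the vanishing condition of ★ `IsLocCuspidal H τc mτ fτ`
(`Theorems/R90S2ArchLocalCuspidalDefs.lean` :138, binder `∀ c : ConjClasses ↥(archLocal L N H τc), IsRegNonEllipticMat (((Quotient.out c : ↥(archLocal L N H τc)) :
GL (Fin N) ℂ) : Matrix (Fin N) (Fin N) ℂ) → …`) is NOT VACUOUS at a place `τc` where `σ_τc H` has signature `(2,1)`: there IS a conjugacy class of
`U(σ_τc H)(ℂ)` whose chosen representative is regular non-elliptic (`exists_conjClasses_isRegNonEllipticMat_archLocal`), whereas at the compact places the class is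
empty (★ `not_isRegNonEllipticMat_archLocal_of_posDef`).  Same for the rank-2 block `U(1,1)` (`exists_conjClasses_isRegNonEllipticMat_archLocal_two`).

CONTENTS
* §1 `IsRegNonEllipticMat` passes between `g ∈ U(σ_τc H)(ℂ)` and the chosen representative `Quotient.out (ConjClasses.mk g)` of its conjugacy class
  (★ p863699 `isRegNonEllipticMat_out_mk`, cited BY NAME — audit1 PRE-BOX F1), so an ELEMENT witness gives a CLASS witness (`exists_conjClasses_isRegNonEllipticMat_archLocal_of_exists`).
* §2 THE `U(2,1)` WITNESS in the ball model `J = diag(1,1,−1)`: the boost ★ `BallModel.boostMat c d` (`c² − d² = 1`, ★ `boostMat_mem`) is conjugate by the rational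
  frame `R = [[1,0,1],[0,1,0],[1,0,−1]]` to `diag(c+d, 1, c−d)`, so `charpoly (boostMat c d) = (X − (c+d))(X − 1)(X − (c−d))` (`charpoly_boostMat`); at
  `(c,d) = (5∕4, 3∕4)` the eigenvalues are `2, 1, 2⁻¹` — distinct, and `‖2‖ ≠ 1`: `isRegNonEllipticMat_boostMat` (the «diagonal-hyperbolic element» up to the frame `R`).
* §3 TRANSPORT BY A FRAME, any `N`: `u ∈ U(⋆, J₀)` regular non-elliptic and `σ(T)ᵀ·σ_τc(H)·T = J₀` give `T u T⁻¹ ∈ U(σ_τc H)(ℂ)` regular non-elliptic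
  (★ `unitaryGroupOfFormCongrOfEq`, ★ p862685 `isRegNonEllipticMat_conj_gl`; `exists_isRegNonEllipticMat_archLocal_of_formCongr`, class level
  `exists_conjClasses_isRegNonEllipticMat_archLocal_of_formCongr`).
* §4 `N = 3` over the S2-R13 frame binders `(T, hT : Tᴴ·σ_τc(H)·T = BallModel.J)` of ★ `locFrame` (VERBATIM binder shape of ★ `R90S2ArchLocalCuspidalDefs` §3; ★ `formCongr_star`
  converts to the `formCongr` spelling, ★ `U21_eq_unitaryGroupOfForm` moves the §2 witness into `U(⋆, diag(1,1,−1))`):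
  `exists_isRegNonEllipticMat_archLocal`, `exists_conjClasses_isRegNonEllipticMat_archLocal`.
* §5 `N = 2`, the `U(1,1)` block over a frame to the antidiagonal form `[[0,1],[1,0]]` of ★ `exists_isRegNonEllipticMat_two`:
  `exists_isRegNonEllipticMat_archLocal_two`, `exists_conjClasses_isRegNonEllipticMat_archLocal_two`.
* §6 READ-BACK on ★ `IsLocCuspidal` itself: at a `(2,1)`-place a locally cuspidal `fτ` has a class orbital integral that is REQUIRED to vanish and DOES
  (`IsLocCuspidal.exists_classOrbitalIntegral_eq_zero`) — the clause bites; nothing cuspidal is constructed.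

Sources: Rogawski 1990, §3.1 p. 19 (regular ∕ elliptic elements), §4.9 (cuspidal functions at `∞`: orbital integrals vanish at the regular non-elliptic
elements), §14.4 (the archimedean situation `U(2,1) × compact`); Knapp 1986, Ch. I §1 (`U(p,q)`, eigenvalues); Jacobowitz 1990, Ch. 2 §1 (the ball model
`J = diag(1,1,−1)` and its boosts); Platonov–Rapinchuk 1994, §2.3 (change of frame `g ↦ T g T⁻¹`).
-/

set_option autoImplicit false
-- the mandated namespace repeats the single-problem summit's segment (`HodgeConjecture.HodgeConjecture`)
set_option linter.dupNamespace false

noncomputable section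

open NumberField NumberField.InfinitePlace Polynomial
open scoped Matrix MatrixGroups ComplexConjugate ComplexOrder
open Literature.NumberTheory.Automorphic Literature.NumberTheory.Automorphic.UnitaryGroup
open Literature.Geometry.ComplexHyperbolic Literature.Geometry.ComplexHyperbolic.BallModel

namespace Summit.HodgeConjecture.HodgeConjecture.R90.S2

/-! ## §1 From an element to its conjugacy class [§3.1 p. 19] -/

section ClassRep

variable {L : Type} [Field L] {N : ℕ} (H : Matrix (Fin N) (Fin N) L) (τc : {w : InfinitePlace L // w.IsComplex})

/-- A regular non-elliptic ELEMENT of `U(σ_τc H)(ℂ)` yields a conjugacy CLASS whose chosen representative is regular non-elliptic (★ p863699 `isRegNonEllipticMat_out_mk`: the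
predicate is a class function, ★ p862685). [cite: Rogawski1990, §3.1 p. 19; §4.9] -/
theorem exists_conjClasses_isRegNonEllipticMat_archLocal_of_exists
    (h : ∃ g : ↥(archLocal L N H τc), IsRegNonEllipticMat ((g : GL (Fin N) ℂ) : Matrix (Fin N) (Fin N) ℂ)) :
    ∃ c : ConjClasses ↥(archLocal L N H τc),
      IsRegNonEllipticMat (((Quotient.out c : ↥(archLocal L N H τc)) : GL (Fin N) ℂ) : Matrix (Fin N) (Fin N) ℂ) := by
  obtain ⟨g, hg⟩ := h
  exact ⟨ConjClasses.mk g, (isRegNonEllipticMat_out_mk H τc g).2 hg⟩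

end ClassRep

/-! ## §2 The `U(2,1)` witness: a boost of the ball model [Jacobowitz1990 Ch. 2 §1; Rogawski1990 §3.1] -/

/-- `R · R' = 1` for the rational frame `R = [[1,0,1],[0,1,0],[1,0,−1]]`, `R' = ½·[[1,0,1],[0,2,0],[1,0,−1]]` diagonalising every boost. [folklore] -/
theorem boostFrame_mul_boostFrameInv :
    !![(1 : ℂ), 0, 1; 0, 1, 0; 1, 0, -1] * !![(2⁻¹ : ℂ), 0, 2⁻¹; 0, 1, 0; 2⁻¹, 0, -2⁻¹] = 1 := by
  ext i j
  fin_cases i <;> fin_cases j <;> simp [Matrix.mul_apply, Fin.sum_univ_three] <;> norm_num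

/-- `R' · R = 1`. [folklore] -/
theorem boostFrameInv_mul_boostFrame :
    !![(2⁻¹ : ℂ), 0, 2⁻¹; 0, 1, 0; 2⁻¹, 0, -2⁻¹] * !![(1 : ℂ), 0, 1; 0, 1, 0; 1, 0, -1] = 1 := by
  ext i j
  fin_cases i <;> fin_cases j <;> simp [Matrix.mul_apply, Fin.sum_univ_three] <;> norm_num

/-- **Diagonalisation of a boost**: `boostMat c d = R · diag(c+d, 1, c−d) · R'`. [cite: Jacobowitz1990, Ch. 2 §1 (p. 40)] -/
theorem boostMat_eq_conj_diagonal (c d : ℝ) :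
    boostMat c d = !![(1 : ℂ), 0, 1; 0, 1, 0; 1, 0, -1] * Matrix.diagonal ![(c : ℂ) + d, 1, (c : ℂ) - d] *
      !![(2⁻¹ : ℂ), 0, 2⁻¹; 0, 1, 0; 2⁻¹, 0, -2⁻¹] := by
  ext i j
  fin_cases i <;> fin_cases j <;> simp [boostMat, Matrix.mul_apply, Fin.sum_univ_three, Matrix.vecMul_diagonal] <;> ring

/-- **Characteristic polynomial of a boost**: `charpoly (boostMat c d) = (X − (c+d)) (X − 1) (X − (c−d))` — the eigenvalues of the boost are `c + d`, `1`, `c − d`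
(conjugate `diag(c+d, 1, c−d)` by the frame `R ∈ GL₃(ℂ)`: ★ p862685 `charpoly_conj_units`, Mathlib ★ `Matrix.charpoly_diagonal`). [cite: Jacobowitz1990, Ch. 2 §1 (p. 40)]
[cite: Rogawski1990, §3.1 p. 19] -/
theorem charpoly_boostMat (c d : ℝ) :
    (boostMat c d).charpoly = (X - C ((c : ℂ) + d)) * (X - C 1) * (X - C ((c : ℂ) - d)) := by
  let R : GL (Fin 3) ℂ :=
    ⟨!![(1 : ℂ), 0, 1; 0, 1, 0; 1, 0, -1], !![(2⁻¹ : ℂ), 0, 2⁻¹; 0, 1, 0; 2⁻¹, 0, -2⁻¹], boostFrame_mul_boostFrameInv, boostFrameInv_mul_boostFrame⟩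
  have hconj : boostMat c d = (R : Matrix (Fin 3) (Fin 3) ℂ) * Matrix.diagonal ![(c : ℂ) + d, 1, (c : ℂ) - d] * ((R⁻¹ : GL (Fin 3) ℂ) : Matrix (Fin 3) (Fin 3) ℂ) :=
    boostMat_eq_conj_diagonal c d
  rw [hconj, charpoly_conj_units, Matrix.charpoly_diagonal, Fin.prod_univ_three]
  rfl

/-- **THE `U(2,1)` WITNESS**: the boost `boostMat (5∕4) (3∕4)` (in `U(2,1)` of the ball model by ★ `boostMat_mem`, `(5∕4)² − (3∕4)² = 1`) is REGULAR NON-ELLIPTIC —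
its eigenvalues `2, 1, 2⁻¹` are distinct (`charpoly` separable) and `‖2‖ = 2 ≠ 1`. [cite: Rogawski1990, §3.1 p. 19; §4.9] [cite: Jacobowitz1990, Ch. 2 §1 (p. 40)] -/
theorem isRegNonEllipticMat_boostMat : IsRegNonEllipticMat (boostMat (5 / 4) (3 / 4)) := by
  have h₁ : (((5 / 4 : ℝ) : ℂ)) + ((3 / 4 : ℝ) : ℂ) = 2 := by push_cast; norm_num
  have h₂ : (((5 / 4 : ℝ) : ℂ)) - ((3 / 4 : ℝ) : ℂ) = 2⁻¹ := by push_cast; norm_num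
  have hchar : (boostMat (5 / 4) (3 / 4)).charpoly = (X - C 2) * (X - C 1) * (X - C 2⁻¹) := by
    rw [charpoly_boostMat, h₁, h₂]
  refine ⟨?_, ?_⟩
  · -- separable: three pairwise distinct linear factors
    rw [isRegSemisimpleMat_iff, hchar]
    have h21 : (2 : ℂ) - 1 ≠ 0 := by norm_num
    have h2h : (2 : ℂ) - 2⁻¹ ≠ 0 := by norm_num
    have h1h : (1 : ℂ) - 2⁻¹ ≠ 0 := by norm_num
    exact (Polynomial.separable_X_sub_C.mul Polynomial.separable_X_sub_C
        (Polynomial.isCoprime_X_sub_C_of_isUnit_sub (isUnit_iff_ne_zero.2 h21))).mul Polynomial.separable_X_sub_C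
      ((Polynomial.isCoprime_X_sub_C_of_isUnit_sub (isUnit_iff_ne_zero.2 h2h)).mul_left
        (Polynomial.isCoprime_X_sub_C_of_isUnit_sub (isUnit_iff_ne_zero.2 h1h)))
  · -- not elliptic: `2` is a root with `‖2‖ = 2 ≠ 1`
    rw [isEllipticMat_iff_isRoot]
    intro h
    have h2 : ‖(2 : ℂ)‖ = 1 := h 2 (by rw [hchar]; simp)
    norm_num at h2

/-- The witness as an element of `U(2,1)` (★ `mkU21`, ★ `boostMat_mem`): there is a regular non-elliptic element of `U(2,1)`. [cite: Rogawski1990, §3.1 p. 19; §4.9] -/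
theorem exists_isRegNonEllipticMat_U21 : ∃ u : U21, IsRegNonEllipticMat (((u : GL (Fin 3) ℂ)) : Matrix (Fin 3) (Fin 3) ℂ) :=
  ⟨mkU21 (boostMat (5 / 4) (3 / 4)) (boostMat_mem _ _ (by norm_num)), isRegNonEllipticMat_boostMat⟩

/-! ## §3 Transport by a frame, any rank `N` [PlatonovRapinchuk1994 §2.3] -/

section Transport

variable {L : Type} [Field L] {N : ℕ} (H : Matrix (Fin N) (Fin N) L) (τc : {w : InfinitePlace L // w.IsComplex})

/-- **Transport of a witness by a frame**: if `σ(T)ᵀ · σ_τc(H) · T = J₀` (★ `formCongr`) and `u ∈ U(⋆, J₀)` is regular non-elliptic, then `T u T⁻¹ ∈ U(σ_τc H)(ℂ)`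
(★ `unitaryGroupOfFormCongrOfEq`) is regular non-elliptic (★ p862685 `isRegNonEllipticMat_conj_gl`). [cite: PlatonovRapinchuk1994, §2.3] [cite: Rogawski1990, §3.1 p. 19] -/
theorem exists_isRegNonEllipticMat_archLocal_of_formCongr (T : GL (Fin N) ℂ) (J₀ : Matrix (Fin N) (Fin N) ℂ)
    (h : formCongr (starRingEnd ℂ) T (H.map τc.1.embedding) = J₀) (u : ↥(unitaryGroupOfForm (starRingEnd ℂ) J₀))
    (hu : IsRegNonEllipticMat (((u : GL (Fin N) ℂ)) : Matrix (Fin N) (Fin N) ℂ)) :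
    ∃ g : ↥(archLocal L N H τc), IsRegNonEllipticMat ((g : GL (Fin N) ℂ) : Matrix (Fin N) (Fin N) ℂ) :=
  ⟨⟨T * (u : GL (Fin N) ℂ) * T⁻¹, (unitaryGroupOfFormCongrOfEq (starRingEnd ℂ) T (H.map τc.1.embedding) J₀ h u).2⟩,
    (isRegNonEllipticMat_conj_gl T (u : GL (Fin N) ℂ)).2 hu⟩

/-- Class level of the transport: a conjugacy class of `U(σ_τc H)(ℂ)` with regular non-elliptic chosen representative. [cite: PlatonovRapinchuk1994, §2.3]
[cite: Rogawski1990, §3.1 p. 19; §4.9] -/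
theorem exists_conjClasses_isRegNonEllipticMat_archLocal_of_formCongr (T : GL (Fin N) ℂ) (J₀ : Matrix (Fin N) (Fin N) ℂ)
    (h : formCongr (starRingEnd ℂ) T (H.map τc.1.embedding) = J₀) (u : ↥(unitaryGroupOfForm (starRingEnd ℂ) J₀))
    (hu : IsRegNonEllipticMat (((u : GL (Fin N) ℂ)) : Matrix (Fin N) (Fin N) ℂ)) :
    ∃ c : ConjClasses ↥(archLocal L N H τc), IsRegNonEllipticMat (((Quotient.out c : ↥(archLocal L N H τc)) : GL (Fin N) ℂ) : Matrix (Fin N) (Fin N) ℂ) :=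
  exists_conjClasses_isRegNonEllipticMat_archLocal_of_exists H τc (exists_isRegNonEllipticMat_archLocal_of_formCongr H τc T J₀ h u hu)

end Transport

/-! ## §4 `N = 3`: the S2-R13 frame `(T, hT)` of ★ `locFrame` [Rogawski1990 §14.4] -/

section Three

variable {L : Type} [Field L] (H : Matrix (Fin 3) (Fin 3) L) (τc : {w : InfinitePlace L // w.IsComplex})

/-- **F-C3 NON-EMPTINESS at a `(2,1)`-place, element level**: given a frame `Tᴴ · σ_τc(H) · T = diag(1,1,−1)` (the binders of ★ `locFrame`), `U(σ_τc H)(ℂ)` contains a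
regular non-elliptic element — the transported boost `T · boostMat(5∕4, 3∕4) · T⁻¹`. [cite: Rogawski1990, §3.1 p. 19; §4.9; §14.4] [cite: Jacobowitz1990, Ch. 2 §1 (p. 40)] -/
theorem exists_isRegNonEllipticMat_archLocal (T : GL (Fin 3) ℂ)
    (hT : (T : Matrix (Fin 3) (Fin 3) ℂ)ᴴ * H.map τc.1.embedding * (T : Matrix (Fin 3) (Fin 3) ℂ) = Literature.Geometry.ComplexHyperbolic.BallModel.J) :
    ∃ g : ↥(archLocal L 3 H τc), IsRegNonEllipticMat ((g : GL (Fin 3) ℂ) : Matrix (Fin 3) (Fin 3) ℂ) := by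
  obtain ⟨u, hu⟩ := exists_isRegNonEllipticMat_U21
  exact exists_isRegNonEllipticMat_archLocal_of_formCongr H τc T BallModel.J ((formCongr_star T _).trans hT)
    ⟨(u : GL (Fin 3) ℂ), by rw [← U21_eq_unitaryGroupOfForm]; exact u.2⟩ hu

/-- **F-C3 NON-EMPTINESS at a `(2,1)`-place, CLASS level** — the binder shape of ★ `IsLocCuspidal` (`Theorems/R90S2ArchLocalCuspidalDefs.lean` :138): there is a
conjugacy class `c` of `U(σ_τc H)(ℂ)` with `IsRegNonEllipticMat (Quotient.out c)`, so the vanishing clause of `IsLocCuspidal H τc mτ fτ` has content at `τc`.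
[cite: Rogawski1990, §3.1 p. 19; §4.9; §14.4] -/
theorem exists_conjClasses_isRegNonEllipticMat_archLocal (T : GL (Fin 3) ℂ)
    (hT : (T : Matrix (Fin 3) (Fin 3) ℂ)ᴴ * H.map τc.1.embedding * (T : Matrix (Fin 3) (Fin 3) ℂ) = Literature.Geometry.ComplexHyperbolic.BallModel.J) :
    ∃ c : ConjClasses ↥(archLocal L 3 H τc), IsRegNonEllipticMat (((Quotient.out c : ↥(archLocal L 3 H τc)) : GL (Fin 3) ℂ) : Matrix (Fin 3) (Fin 3) ℂ) :=
  exists_conjClasses_isRegNonEllipticMat_archLocal_of_exists H τc (exists_isRegNonEllipticMat_archLocal H τc T hT)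

end Three

/-! ## §5 `N = 2`: the `U(1,1)` block over a frame to the antidiagonal form [Rogawski1990 §3.1, §4.9] -/

section Two

variable {L : Type} [Field L] (H₂ : Matrix (Fin 2) (Fin 2) L) (τc : {w : InfinitePlace L // w.IsComplex})

/-- A matrix preserving a non-degenerate form is invertible: `gᴴ J₀ g = J₀`, `det J₀ ≠ 0` ⟹ `det g ≠ 0` (★ `BallModel.det_ne_zero_of_preserves` is the ball-model case).
-- cf. ★ `Literature.GroupTheory.ArithmeticGroups.det_ne_zero_of_unitary` (`UnitaryRealApproximationGL` :113, generic index type; not in this file's import cone — audit1 A1).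
[folklore] -/
theorem det_ne_zero_of_conjTranspose_mul_mul {N : ℕ} {J₀ g : Matrix (Fin N) (Fin N) ℂ} (hJ : J₀.det ≠ 0) (h : gᴴ * J₀ * g = J₀) : g.det ≠ 0 := by
  intro h0
  have := congrArg Matrix.det h
  rw [Matrix.det_mul, Matrix.det_mul, h0, mul_zero] at this
  exact hJ this.symm

/-- There is a regular non-elliptic element of `U(⋆, [[0,1],[1,0]])` (★ `exists_isRegNonEllipticMat_two`: `diag(2, 2⁻¹)`), as a group element.
[cite: Rogawski1990, §3.1 p. 19; §4.9] -/
theorem exists_isRegNonEllipticMat_unitaryGroupOfForm_two :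
    ∃ u : ↥(unitaryGroupOfForm (starRingEnd ℂ) !![(0 : ℂ), 1; 1, 0]), IsRegNonEllipticMat (((u : GL (Fin 2) ℂ)) : Matrix (Fin 2) (Fin 2) ℂ) := by
  obtain ⟨g, hg, hreg⟩ := exists_isRegNonEllipticMat_two
  have hJ : (!![(0 : ℂ), 1; 1, 0]).det ≠ 0 := by simp [Matrix.det_fin_two]
  refine ⟨⟨Matrix.GeneralLinearGroup.mkOfDetNeZero g (det_ne_zero_of_conjTranspose_mul_mul hJ hg),
    (mem_unitaryGroupOfForm_star_iff_conjTranspose _ _).2 hg⟩, hreg⟩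

/-- **F-C3 NON-EMPTINESS on the `U(1,1)` block, element level**: given a frame `T₂ᴴ · σ_τc(H₂) · T₂ = [[0,1],[1,0]]`, `U(σ_τc H₂)(ℂ)` contains a regular non-elliptic
element (`T₂ · diag(2, 2⁻¹) · T₂⁻¹`). [cite: Rogawski1990, §3.1 p. 19; §4.9] -/
theorem exists_isRegNonEllipticMat_archLocal_two (T₂ : GL (Fin 2) ℂ)
    (hT₂ : (T₂ : Matrix (Fin 2) (Fin 2) ℂ)ᴴ * H₂.map τc.1.embedding * (T₂ : Matrix (Fin 2) (Fin 2) ℂ) = !![(0 : ℂ), 1; 1, 0]) :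
    ∃ g : ↥(archLocal L 2 H₂ τc), IsRegNonEllipticMat ((g : GL (Fin 2) ℂ) : Matrix (Fin 2) (Fin 2) ℂ) := by
  obtain ⟨u, hu⟩ := exists_isRegNonEllipticMat_unitaryGroupOfForm_two
  exact exists_isRegNonEllipticMat_archLocal_of_formCongr H₂ τc T₂ _ ((formCongr_star T₂ _).trans hT₂) u hu

/-- **F-C3 NON-EMPTINESS on the `U(1,1)` block, CLASS level** (binder shape of ★ `IsLocCuspidal` at `N = 2`). [cite: Rogawski1990, §3.1 p. 19; §4.9] -/
theorem exists_conjClasses_isRegNonEllipticMat_archLocal_two (T₂ : GL (Fin 2) ℂ)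
    (hT₂ : (T₂ : Matrix (Fin 2) (Fin 2) ℂ)ᴴ * H₂.map τc.1.embedding * (T₂ : Matrix (Fin 2) (Fin 2) ℂ) = !![(0 : ℂ), 1; 1, 0]) :
    ∃ c : ConjClasses ↥(archLocal L 2 H₂ τc), IsRegNonEllipticMat (((Quotient.out c : ↥(archLocal L 2 H₂ τc)) : GL (Fin 2) ℂ) : Matrix (Fin 2) (Fin 2) ℂ) :=
  exists_conjClasses_isRegNonEllipticMat_archLocal_of_exists H₂ τc (exists_isRegNonEllipticMat_archLocal_two H₂ τc T₂ hT₂)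

end Two

/-! ## §6 Read-back on ★ `IsLocCuspidal` (`R90S2ArchLocalCuspidalDefs` :138): at a `(2,1)`-place the vanishing clause bites [Rogawski1990 §14.5 p. 240] -/

section ReadBack

variable {L : Type} [Field L] (H : Matrix (Fin 3) (Fin 3) L) (τc : {w : InfinitePlace L // w.IsComplex})

/-- **The vanishing clause of ★ `IsLocCuspidal` has content at a `(2,1)`-place**: given a frame `Tᴴ · σ_τc(H) · T = diag(1,1,−1)`, a locally cuspidal test function `fτ`
(against any local orbital-measure family `mτ`) has a conjugacy class `c` with regular non-elliptic representative — at which the clause APPLIES — and there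
`classOrbitalIntegral mτ fτ c = 0` (§4 + the definition).  At a compact place no such `c` exists (★ `isLocCuspidal_of_posDef`). [cite: Rogawski1990, §14.5 p. 240; §4.9]
[cite: Arthur1988InvariantTraceFormulaII, §7] -/
theorem IsLocCuspidal.exists_classOrbitalIntegral_eq_zero
    [∀ γ : ↥(archLocal L 3 H τc), MeasurableSpace (↥(archLocal L 3 H τc) ⧸ Subgroup.centralizer ({γ} : Set ↥(archLocal L 3 H τc)))]
    (T : GL (Fin 3) ℂ)
    (hT : (T : Matrix (Fin 3) (Fin 3) ℂ)ᴴ * H.map τc.1.embedding * (T : Matrix (Fin 3) (Fin 3) ℂ) = Literature.Geometry.ComplexHyperbolic.BallModel.J)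
    {mτ : OrbitalMeasureFamily ↥(archLocal L 3 H τc)} {fτ : ↥(archLocal L 3 H τc) → ℂ} (h : IsLocCuspidal H τc mτ fτ) :
    ∃ c : ConjClasses ↥(archLocal L 3 H τc),
      IsRegNonEllipticMat (((Quotient.out c : ↥(archLocal L 3 H τc)) : GL (Fin 3) ℂ) : Matrix (Fin 3) (Fin 3) ℂ) ∧ classOrbitalIntegral mτ fτ c = 0 := by
  obtain ⟨c, hc⟩ := exists_conjClasses_isRegNonEllipticMat_archLocal H τc T hT
  exact ⟨c, hc, h c hc⟩

end ReadBack

end Summit.HodgeConjecture.HodgeConjecture.R90.S2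

end
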